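import Summits.BirchSwinnertonDyer.Rank1Residual.JET.RingClassTransverseLagrangian
import HarnessLib

/-!
# T1 JET (cell `bsd-jet`), road K: the END FORMS' closed binder `h𝒯sd`, RE-CLOSED WITH GROSS'S UNIT
# GUARD and discharged BY NAME (typer seat `bsd-jet-ty` g7; 0 classes move)

HONEST FRAMING (programme file §HONESTY, verbatim): «no tranche here proves BSD; ARM L moves the
LITERAL column of an r ≤ 1 census into the kernel-proved-modulo-named-print column.» THEOREMS ONLY
(no definition, no named fact, no `sorry`); nothing is booked; typed ≠ proved ≠ endorsed.

WHAT. The five road-K END FORMS (`Theorems/Rank1ResidualJetCarrier{Ne,Mult,Add}EndForm`,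
`…Carrier{Ne,P}EndFormNoHloc`) carry ONE closed hypothesis
`h𝒯sd : ∀ W, ∀ K imaginary quadratic, ∀ ι p k, p ≠ 2, ∀ c square-free with (Zhang–Kolyvagin ∧ k ≤ M(ℓ))
for ℓ ∣ c, ∀ 𝒯 (the intrinsic transverse ⨅-family), ∀ Weil datum, ∀ perfect inv, ∀ v ∣ c,
inv.dualTransported 𝒯 (weilDualIntertwining …) (inr v) = 𝒯 (inr v)` — the print's «`H¹_tr(K_λ, E[p^k])` is
self-dual for the local Tate pairing» (Howard 2004 Prop. 2.1.9 (ii); Jetchev 2008 §3.1.2) WITHOUT the print's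
standing assumption `d_K ∉ {−3, −4}` (Gross 1991 §1 «we assume D ≠ 3, 4», so that `𝓞_K^× = {±1}` and
`[K[ℓ] : K[1]] = ℓ + 1`).  As closed, that hypothesis quantifies over `K` and `p` internally and is NOT
satisfiable: at `K = ℚ(√−3)` (`u_K = [𝓞_K^× : ℤ^×] = 3`, `K[1] = K`), `p = 3`, `k ≥ 1`, `c = ℓ` a
Zhang–Kolyvagin prime with `v₃(ℓ + 1) = k` exactly, `G_ℓ = Gal(K[ℓ]/K)` is cyclic of order `(ℓ + 1)/3`
(Cox, Thm. 7.24), `E[3^k] ⊆ E(K_λ)`, so `H¹_tr(K_λ, E[3^k]) = Hom(G_ℓ, E[3^k])` has order `3^{2k−2}` (the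
inflation–restriction mechanism of `JET/RingClassTransverseCount`) while `#H¹(K_λ, E[3^k]) = 3^{4k}`, whence
`#Tr^⊥ = 3^{2k+2} ≠ #Tr` (paper computation recorded on the cell's STATUS/INBOX 2026-08-27 ≈11:3xZ; no kernel
refutation is claimed here).  THIS FILE states the same closed binder WITH the guard inserted —
`IsImaginaryQuadratic K → NumberField.discr K ≠ -3 → NumberField.discr K ≠ -4 → …`, everything else verbatim
— and proves it: `JET.RingClassTransverse.localTransverseFamily_selfDual_forall`.  The END FORMS have `hD3`,
`hD4` in context, so re-closing their binder is the two-arrow insertion plus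
`h𝒯sd := localTransverseFamily_selfDual_forall` (or: feed the sibling `dualTransported_eq_of_localTransverseFamily`
in frame).  The binder's missing `1 ≤ k` is harmless and absorbed here: for `k = 0`, `E[1] = 0`, every class of
`H¹(K_v, E[1])` is killed by `p^0 = 1` (`nsmul_continuousCohomology_one_eq_zero`), so both sides are `⊥`.

References: [cite: Howard2004HeegnerKolyvagin, Prop. 2.1.9 (ii), §2.2] [cite: MazurRubin2004, Prop. 1.3.2 (ii)
(p. 12)] [cite: Jetchev2008, §3.1.2 (p. 814)] [cite: GrossLMS1991, §1 (p. 235: «we assume D ≠ 3, 4»), §3]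
[cite: Cox1989, Thm. 7.24] [cite: WZhang2014, Notations (xii)].

## Tree search
`lean search 'localTransverseFamily_selfDual|dualTransported_eq_of_localTransverseFamily'`: the siblings
`dualTransported_eq_of_localTransverseFamily` (p525648; hypotheses `d_K < −4`, `1 ≤ k`, `∀ ℓ ∣ c, k ≤ M(ℓ)`) and
`localTransverseFamily_selfDual` (p526467; the `_of_localFacts'` binder over `hD3 hD4 hk mInf hkM`); this file is
the END-FORM-shaped closure, nothing else.
-/

set_option autoImplicit false

noncomputable section

open scoped Classical Pointwise

namespace Summit.BirchSwinnertonDyer.Rank1Residual.JET.RingClassTransverse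

open CategoryTheory ContinuousCohomology WeierstrassCurve Field Function NumberField IsDedekindDomain
open Literature.NumberTheory.EllipticCurves Literature.NumberTheory.EllipticCurves.Jetchev2008
open Literature.NumberTheory.GaloisRepresentations Literature.NumberTheory.GaloisCohomology
open Literature.NumberTheory.GaloisRepresentations.DiscreteGaloisModule (transverseSubgroup SelmerStructure)
open Literature.NumberTheory.Automorphic _root_.TopRep
open Summit.BirchSwinnertonDyer.Rank1Residual.JET.SelmerVocabulary
open scoped ContRepresentation NumberField

/-- **T1, END-FORM SHAPE — the closed binder `h𝒯sd` of the road-K END FORMS with Gross's unit guard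
`d_K ≠ −3, −4` inserted after `IsImaginaryQuadratic K`, everything else verbatim, is a THEOREM.**  For every
`W/ℚ` elliptic globally minimal, `K` imaginary quadratic with `d_K ≠ −3, −4`, `ι`, odd prime `p`, level `k`
(`k = 0` included: then `H¹(K_v, E[1]) = 0`), square-free `c` whose prime factors are Zhang–Kolyvagin primes with
`k ≤ M(ℓ)`: every Selmer structure `𝒯` whose finite-place conditions are the intrinsic transverse `⨅` is
self-dual at every `v ∣ c` for every Weil datum and every perfect family of local invariants.  Without the
guard the closed statement fails at `(d_K, p) = (−3, 3)` (module docstring).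
PLUG (END FORMS, binder re-closed with the two arrows): `h𝒯sd := localTransverseFamily_selfDual_forall`.
[cite: Howard2004HeegnerKolyvagin, Prop. 2.1.9 (ii)] [cite: MazurRubin2004, Prop. 1.3.2 (ii) (p. 12)]
[cite: Jetchev2008, §3.1.2 (p. 814)] [cite: GrossLMS1991, §1, §3] -/
theorem localTransverseFamily_selfDual_forall :
    ∀ (W : WeierstrassCurve ℚ) [W.IsElliptic] [W.IsGloballyMinimal]
      (K : Type) [Field K] [NumberField K], IsImaginaryQuadratic K →
      NumberField.discr K ≠ -3 → NumberField.discr K ≠ -4 →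
      ∀ (ι : K →+* ℂ) [∀ j : ℕ, NumberField (ringClassField K ι j)]
      (p k : ℕ) [Fact p.Prime] [NeZero (p ^ k)] [Finite (geomTorsion (W.baseChange K) ((p ^ k : ℕ) : ℤ))],
      p ≠ 2 → ∀ (c : ℕ), Squarefree c → (∀ ℓ ∈ c.primeFactors,
        Zhang2014.IsKolyvaginPrime (W.conductorNorm ℤ) W K p ℓ ∧ k ≤ Zhang2014.kolyvaginIndex W p ℓ) →
      ∀ (𝒯 : SelmerStructure ((W.baseChange K).torsionGaloisModule ((p ^ k : ℕ) : ℤ))),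
      (∀ v : HeightOneSpectrum (𝓞 K), 𝒯 (Sum.inr v) =
        ⨅ ℓ ∈ c.primeFactors.filter (fun ℓ : ℕ ↦ ((ℓ : ℕ) : 𝓞 K) ∈ v.asIdeal),
          ⨅ (w' : HeightOneSpectrum (𝓞 (ringClassField K ι ℓ))) (_ : w'.asIdeal.LiesOver v.asIdeal),
            letI := (adicCompletionOfLiesOver K (ringClassField K ι ℓ) v w').toAlgebra
            transverseSubgroup (GaloisRep.toLocal v ((W.baseChange K).torsionGaloisModule ((p ^ k : ℕ) : ℤ)))
              (w'.adicCompletion (ringClassField K ι ℓ))) →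
      ∀ (e : geomTorsion (W.baseChange K) ((p ^ k : ℕ) : ℤ) →
          geomTorsion (W.baseChange K) ((p ^ k : ℕ) : ℤ) → AlgebraicClosure K)
        (hμ : ∀ S T, e S T ^ (p ^ k) = 1)
        (hadd₁ : ∀ S₁ S₂ T, e (S₁ + S₂) T = e S₁ T * e S₂ T)
        (hadd₂ : ∀ S T₁ T₂, e S (T₁ + T₂) = e S T₁ * e S T₂)
        (hgal : ∀ (g : absoluteGaloisGroup K) (S T : geomTorsion (W.baseChange K) ((p ^ k : ℕ) : ℤ)),
          g • e S T = e (g • S) (g • T)),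
      (∀ T, e T T = 1) → (∀ T, (∀ S, e S T = 1) → T = 0) →
      ∀ inv : LocalInvariants K (p ^ k), inv.IsPerfect → ∀ v ∈ placesDividing K c,
      inv.dualTransported 𝒯 (weilDualIntertwining (W.baseChange K) (p ^ k) e hμ hadd₁ hadd₂ hgal)
        (Sum.inr v) = 𝒯 (Sum.inr v) := by
  intro W _ _ K _ _ hK hD3 hD4 ι _ p k _ _ _ hp2 c hc hcK 𝒯 h𝒯 e hμ hadd₁ hadd₂ hgal halt hnondeg inv hperf v hv
  rcases Nat.eq_zero_or_pos k with hk0 | hk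
  · -- `k = 0`: `E[1] = 0`, so every class of `H¹(K_v, E[p^0])` is killed by `p^0 = 1`; both sides are `⊥`
    have h1 : p ^ k = 1 := by rw [hk0, pow_zero]
    have hA : ∀ x : galoisCohomology
        (((W.baseChange K).torsionGaloisModule ((p ^ k : ℕ) : ℤ)).toLocal (Sum.inr v : Place K)) 1,
        (p ^ k) • x = 0 :=
      nsmul_continuousCohomology_one_eq_zero _ (p ^ k)
        (fun T : geomTorsion (W.baseChange K) ((p ^ k : ℕ) : ℤ) ↦ AddSubgroup.torsionBy.nsmul T)
    have hzero : ∀ x : galoisCohomology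
        (((W.baseChange K).torsionGaloisModule ((p ^ k : ℕ) : ℤ)).toLocal (Sum.inr v : Place K)) 1, x = 0 := by
      intro x
      have hx : (p ^ k) • x = (1 : ℕ) • x := congrArg (fun n : ℕ ↦ n • x) h1
      rw [one_nsmul] at hx
      exact hx.symm.trans (hA x)
    ext x
    rw [hzero x]
    exact ⟨fun _ ↦ zero_mem _, fun _ ↦ zero_mem _⟩
  · -- `1 ≤ k`: the sibling, after `d_K < −4` (`d_K < 0`, `|d_K| > 2` by Minkowski; as in
    -- `X11b.KolyvaginAssembly.discr_lt_neg_four`)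
    have hD : NumberField.discr K < -4 := by
      have hneg : NumberField.discr K < 0 := hK.discr_neg
      have habs : 2 < |NumberField.discr K| := NumberField.abs_discr_gt_two (by rw [hK.1]; omega)
      rw [abs_of_neg hneg] at habs
      omega
    exact dualTransported_eq_of_localTransverseFamily W K hK hD ι p hp2 k (Nat.one_le_iff_ne_zero.mpr hk.ne') c
      hc (fun ℓ hℓ ↦ (hcK ℓ hℓ).1) (fun ℓ hℓ ↦ (hcK ℓ hℓ).2) 𝒯 h𝒯 e hμ hadd₁ hadd₂ hgal halt hnondeg inv
      hperf v hv

end Summit.BirchSwinnertonDyer.Rank1Residual.JET.RingClassTransverse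

end
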